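import Literature.AnabelianGeometry.SemiGraphs.CoveringComparison
import Literature.AnabelianGeometry.SemiGraphs.HomRestrict
import Literature.AnabelianGeometry.SemiGraphs.SemiGraphLocal

/-!
# Restricting the covering `𝒢_A → 𝒢` to a sub-semi-graph: the comparison functor — DEFINITIONS

Mochizuki, *Semi-graphs of anabelioids*, Publ. RIMS **42** (2006) 221–322, §2, proof of Corollary
2.7 (i), author's manuscript p. 30 [cite: MochizukiSemiAnbd2006, Cor. 2.7(i) p.30]: for the finite
étale covering `𝒢′ → 𝒢` attached to `A ∈ B(𝒢)` "whose restriction to `ℍ` … we denote by `ℋ′ → ℍ`",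
the connected components `ℋ″` of `ℋ′` are used as finite étale coverings of `𝒢_ℍ` in their own
right ("`ℋ′` injects into `𝒢′` as a subgraph … Thus, assertion (i) follows from Proposition 2.6").
For the CONSTRUCTED covering `φ := A.coveringHomCan : 𝒢_A → 𝒢` (`CoveringOfObject.lean`,
`CoveringHomCanonical.lean`, abc-iut-L3-t5) and a sub-semi-graph `K ⊆ 𝔾_A` over `ℍ ⊆ 𝔾`, this file
DEFINES the functors through which `B(𝒢_A|_K)` is compared with `B(𝒢_ℍ)_{/Z}` (`Z ↪ A|_ℍ` the
sub-object attached to a preimage component `K`, abc-iut-L6-t17's `exists_preimageComponentObject`):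

* `BObj.vK`, `BObj.eK`, `BObj.bK` — the vertices / edges / branches of `K` viewed as vertices /
  edges / branches of `𝔾_{A|_ℍ}`, the covering semi-graph of the restricted object `A|_ℍ ∈ B(𝒢_ℍ)`
  (same underlying vertex of `𝔾`, same component of `S_v`);
* `BObj.reindexRestrict` — the functor `B(𝒢_{A|_ℍ}) ⥤ B(𝒢_A|_K)` "restrict to `K`" (the
  constituents of `𝒢_{A|_ℍ}` at `(w, P)` and of `𝒢_A` at `(w, P)` are the same category
  `Shrink (Over P)`, definitionally);
* `BObj.restrictComparison m` — for a morphism `m : Z ⟶ A|_ℍ` of `B(𝒢_ℍ)`, the comparison functor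
  `Over Z ⥤ B(𝒢_A|_K)`: compose with `m`, apply abc-iut-L3-t5's comparison functor
  `(A|_ℍ).toCovering : Over (A|_ℍ) ⥤ B(𝒢_{A|_ℍ})` (an equivalence, `CoveringEssSurjIso.lean`), restrict
  to `K`;
* `BObj.extendFunctor` — for `K` CLOPEN in the preimage of `ℍ` (`IsClopenIn`: no branch joins `K` to its
  complement; automatic for a preimage component), the extension-by-initial-objects functor
  `B(𝒢_A|_K) ⥤ B(𝒢_{A|_ℍ})` with `extendFunctor ⋙ reindexRestrict ≅ 𝟭` (`extendRestrictIso`) — the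
  tool for fullness / essential surjectivity of `restrictComparison m`.

That `restrictComparison m` is an equivalence with `(φ|_K)^* ≅ (Z × −) ⋙ restrictComparison m`
when `K` is a preimage component and `Z = Z_K` — i.e. that `φ|_K : 𝒢_A|_K → 𝒢_ℍ` is GLOBALLY the
covering of `𝒢_ℍ` attached to `Z_K` (abc-iut-L3-d3's `Hom.IsGlobalCoveringOf`, the hypothesis of the
dictionary fact (D1)) — is the proof-only sequel.  Definitions only; nothing here takes a side on
[IUTchIII] Cor. 3.12.
-/

namespace Literature.AnabelianGeometry.SemiGraphs

namespace SemiGraphOfAnabelioids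

open CategoryTheory CategoryTheory.Limits
open Literature.AnabelianGeometry.Anabelioids

universe v₁ u₁ u

-- As in `CoveringLift.lean` / Mathlib's `Over/Pullback.lean`: the component categories of `𝒢_A|_K` and of
-- `𝒢_{A|_ℍ}` agree only up to unfolding `restrict`/`coveringGraph`, which `simp`/`rw` must be allowed to do.
set_option backward.isDefEq.respectTransparency false

namespace BObj

variable {𝒢 : SemiGraphOfAnabelioids.{v₁, u₁, u}} (A : 𝒢.BObj) (H : 𝒢.graph.Subgraph)
  (K : A.coveringGraph.graph.Subgraph)
  (hV : K.verts ⊆ A.fibreData.proj.vertexMap ⁻¹' H.verts)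
  (hE : K.edges ⊆ A.fibreData.proj.edgeMap ⁻¹' H.edges)

/-! ### `K ⊆ 𝔾_A` inside `𝔾_{A|_ℍ}` -/

/-- A vertex `(w, P)` of `K` as a vertex of the covering semi-graph `𝔾_{A|_ℍ}` of `A|_ℍ`.
[cite: MochizukiSemiAnbd2006, Cor. 2.7(i) p.30] -/
abbrev vK (kc : (A.coveringGraph.restrict K).graph.Vertex) : ((𝒢.restrictFunctor H).obj A).coveringGraph.graph.Vertex :=
  ⟨⟨kc.1.1, hV kc.2⟩, kc.1.2⟩

/-- An edge `(e, Q)` of `K` as an edge of `𝔾_{A|_ℍ}`. [cite: MochizukiSemiAnbd2006, Cor. 2.7(i) p.30] -/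
abbrev eK (ke : (A.coveringGraph.restrict K).graph.Edge) : ((𝒢.restrictFunctor H).obj A).coveringGraph.graph.Edge :=
  ⟨⟨ke.1.1, hE ke.2⟩, ke.1.2⟩

/-- A branch `(b, Q)` of `K` as a branch of `𝔾_{A|_ℍ}`. [cite: MochizukiSemiAnbd2006, Cor. 2.7(i) p.30] -/
abbrev bK (kb : (A.coveringGraph.restrict K).graph.Branch) : ((𝒢.restrictFunctor H).obj A).coveringGraph.graph.Branch :=
  ⟨⟨kb.1.1, hE kb.2⟩, kb.1.2⟩

/-- A branch of `K` abutting to a vertex of `K` abuts, read in `𝔾_{A|_ℍ}`, to that vertex.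
[cite: MochizukiSemiAnbd2006, Cor. 2.7(i) p.30] -/
theorem abuts_bK {kb : (A.coveringGraph.restrict K).graph.Branch} {kc : (A.coveringGraph.restrict K).graph.Vertex}
    (h : (A.coveringGraph.restrict K).graph.abuts kb = some kc) :
    ((𝒢.restrictFunctor H).obj A).coveringGraph.graph.abuts (A.bK H K hE kb) = some (A.vK H K hV kc) := by
  have h1 : A.fibreData.total.abuts kb.1 = some kc.1 :=
    (SemiGraph.Subgraph.abuts_eq_some_iff K kb kc).mp h
  obtain ⟨⟨b, c'⟩, hb⟩ := kb
  obtain ⟨⟨v, c⟩, hv⟩ := kc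
  change (𝒢.graph.abuts b).pbind _ = some _ at h1
  cases hb0 : 𝒢.graph.abuts b with
  | none => simp [hb0] at h1
  | some w =>
    simp only [hb0, Option.pbind_some, Option.some.injEq] at h1
    obtain ⟨hwv, hσ⟩ := Sigma.mk.inj_iff.mp h1
    subst hwv
    have hH : H.toSemiGraph.abuts ⟨b, hE hb⟩ = some ⟨w, hV hv⟩ :=
      (SemiGraph.Subgraph.abuts_eq_some_iff H ⟨b, hE hb⟩ ⟨w, hV hv⟩).mpr hb0
    change (H.toSemiGraph.abuts ⟨b, hE hb⟩).pbind _ = some _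
    simp only [hH, Option.pbind_some, Option.some.injEq]
    exact Sigma.ext rfl hσ

/-! ### Restriction `B(𝒢_{A|_ℍ}) ⥤ B(𝒢_A|_K)` -/

/-- **Restriction to `K`**: the functor `B(𝒢_{A|_ℍ}) ⥤ B(𝒢_A|_K)` keeping the vertex / edge objects
over the vertices / edges of `K` and the gluing isomorphisms along the branches of `K` (the
constituent categories agree definitionally). [cite: MochizukiSemiAnbd2006, Cor. 2.7(i) p.30] -/
noncomputable def reindexRestrict :
    ((𝒢.restrictFunctor H).obj A).coveringGraph.BObj ⥤ (A.coveringGraph.restrict K).BObj :=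
  BObj.lift (fun kc => ((𝒢.restrictFunctor H).obj A).coveringGraph.ρ (A.vK H K hV kc))
    (fun ke => ((𝒢.restrictFunctor H).obj A).coveringGraph.ρE (A.eK H K hE ke))
    (fun kb kc h => ((𝒢.restrictFunctor H).obj A).coveringGraph.ψNatIso (A.bK H K hE kb)
      (A.vK H K hV kc) (A.abuts_bK H K hV hE h))

/-! ### Extension by initial objects `B(𝒢_A|_K) ⥤ B(𝒢_{A|_ℍ})` -/

section Extend

open scoped Classical

/-- `K` is **clopen** in the preimage of `ℍ` (read in `𝔾_{A|_ℍ}`): along every abutting branch, the edge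
lies in `K` iff the vertex does — no branch joins `K` to its complement.  Holds for a preimage component
of a sub-graph (`Hom.IsPreimageComponent.mem_verts_of_abuts` / `mem_edges_of_abuts`). [cite: MochizukiSemiAnbd2006, Cor. 2.7(i) p.30] -/
@[mk_iff] structure IsClopenIn : Prop where
  /-- along an abutting branch, the edge lies in `K` iff the vertex does -/
  clopen : ∀ (bc : ((𝒢.restrictFunctor H).obj A).coveringGraph.graph.Branch)
    (vc : ((𝒢.restrictFunctor H).obj A).coveringGraph.graph.Vertex),
    ((𝒢.restrictFunctor H).obj A).coveringGraph.graph.abuts bc = some vc →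
      ((⟨𝒢.graph.edgeOf bc.1.1, bc.2⟩ : A.fibreData.total.Edge) ∈ K.edges ↔
        (⟨vc.1.1, vc.2⟩ : A.fibreData.total.Vertex) ∈ K.verts)

variable (hcl : A.IsClopenIn H K)

/-- A vertex of `𝔾_{A|_ℍ}` lying in `K`, as a vertex of `K`. [cite: MochizukiSemiAnbd2006, Cor. 2.7(i) p.30] -/
abbrev kV (vc : ((𝒢.restrictFunctor H).obj A).coveringGraph.graph.Vertex)
    (h : (⟨vc.1.1, vc.2⟩ : A.fibreData.total.Vertex) ∈ K.verts) : (A.coveringGraph.restrict K).graph.Vertex :=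
  ⟨⟨vc.1.1, vc.2⟩, h⟩

/-- An edge of `𝔾_{A|_ℍ}` lying in `K`, as an edge of `K`. [cite: MochizukiSemiAnbd2006, Cor. 2.7(i) p.30] -/
abbrev kE (ec : ((𝒢.restrictFunctor H).obj A).coveringGraph.graph.Edge)
    (h : (⟨ec.1.1, ec.2⟩ : A.fibreData.total.Edge) ∈ K.edges) : (A.coveringGraph.restrict K).graph.Edge :=
  ⟨⟨ec.1.1, ec.2⟩, h⟩

/-- A branch of `𝔾_{A|_ℍ}` whose edge lies in `K`, as a branch of `K`.
[cite: MochizukiSemiAnbd2006, Cor. 2.7(i) p.30] -/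
abbrev kB (bc : ((𝒢.restrictFunctor H).obj A).coveringGraph.graph.Branch)
    (h : (⟨𝒢.graph.edgeOf bc.1.1, bc.2⟩ : A.fibreData.total.Edge) ∈ K.edges) : (A.coveringGraph.restrict K).graph.Branch :=
  ⟨⟨bc.1.1, bc.2⟩, h⟩

/-- A branch abutting in `𝔾_{A|_ℍ}` abuts in `K`. [cite: MochizukiSemiAnbd2006, Cor. 2.7(i) p.30] -/
theorem abuts_kB {bc : ((𝒢.restrictFunctor H).obj A).coveringGraph.graph.Branch}
    {vc : ((𝒢.restrictFunctor H).obj A).coveringGraph.graph.Vertex}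
    (h : ((𝒢.restrictFunctor H).obj A).coveringGraph.graph.abuts bc = some vc)
    (he : (⟨𝒢.graph.edgeOf bc.1.1, bc.2⟩ : A.fibreData.total.Edge) ∈ K.edges)
    (hv : (⟨vc.1.1, vc.2⟩ : A.fibreData.total.Vertex) ∈ K.verts) :
    (A.coveringGraph.restrict K).graph.abuts (A.kB H K bc he) = some (A.kV H K vc hv) := by
  apply (SemiGraph.Subgraph.abuts_eq_some_iff K _ _).mpr
  obtain ⟨⟨b, hb⟩, c'⟩ := bc
  obtain ⟨⟨v, hv0⟩, c⟩ := vc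
  change (H.toSemiGraph.abuts ⟨b, hb⟩).pbind _ = some _ at h
  cases hb1 : H.toSemiGraph.abuts ⟨b, hb⟩ with
  | none => simp [hb1] at h
  | some w =>
    simp only [hb1, Option.pbind_some, Option.some.injEq] at h
    obtain ⟨hwv, hσ⟩ := Sigma.mk.inj_iff.mp h
    subst hwv
    have hG : 𝒢.graph.abuts b = some v := (SemiGraph.Subgraph.abuts_eq_some_iff H ⟨b, hb⟩ _).mp hb1
    change (𝒢.graph.abuts b).pbind _ = some _
    simp only [hG, Option.pbind_some, Option.some.injEq]
    exact Sigma.ext rfl hσ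

variable (D : (A.coveringGraph.restrict K).BObj)

/-- The vertex objects of the extension by initial objects: `D_{(w,P)}` on `K`, `∅` off `K`.
[cite: MochizukiSemiAnbd2006, Cor. 2.7(i) p.30] -/
noncomputable def extendS (vc : ((𝒢.restrictFunctor H).obj A).coveringGraph.graph.Vertex) :
    ((𝒢.restrictFunctor H).obj A).coveringGraph.V vc :=
  if h : (⟨vc.1.1, vc.2⟩ : A.fibreData.total.Vertex) ∈ K.verts then D.S (A.kV H K vc h) else ⊥_ _

/-- The edge objects of the extension by initial objects. [cite: MochizukiSemiAnbd2006, Cor. 2.7(i) p.30] -/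
noncomputable def extendT (ec : ((𝒢.restrictFunctor H).obj A).coveringGraph.graph.Edge) :
    ((𝒢.restrictFunctor H).obj A).coveringGraph.E ec :=
  if h : (⟨ec.1.1, ec.2⟩ : A.fibreData.total.Edge) ∈ K.edges then D.T (A.kE H K ec h) else ⊥_ _

/-- On `K` the extended vertex object is the given one. [cite: MochizukiSemiAnbd2006, Cor. 2.7(i) p.30] -/
noncomputable def extendSIso {vc : ((𝒢.restrictFunctor H).obj A).coveringGraph.graph.Vertex}
    (h : (⟨vc.1.1, vc.2⟩ : A.fibreData.total.Vertex) ∈ K.verts) :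
    A.extendS H K D vc ≅ D.S (A.kV H K vc h) :=
  eqToIso (dif_pos h)

/-- On `K` the extended edge object is the given one. [cite: MochizukiSemiAnbd2006, Cor. 2.7(i) p.30] -/
noncomputable def extendTIso {ec : ((𝒢.restrictFunctor H).obj A).coveringGraph.graph.Edge}
    (h : (⟨ec.1.1, ec.2⟩ : A.fibreData.total.Edge) ∈ K.edges) :
    A.extendT H K D ec ≅ D.T (A.kE H K ec h) :=
  eqToIso (dif_pos h)

/-- Off `K` the extended vertex object is initial. [cite: MochizukiSemiAnbd2006, Cor. 2.7(i) p.30] -/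
noncomputable def isInitialExtendS {vc : ((𝒢.restrictFunctor H).obj A).coveringGraph.graph.Vertex}
    (h : (⟨vc.1.1, vc.2⟩ : A.fibreData.total.Vertex) ∉ K.verts) : IsInitial (A.extendS H K D vc) :=
  IsInitial.ofIso initialIsInitial (eqToIso (dif_neg h : A.extendS H K D vc = ⊥_ _).symm)

/-- Off `K` the extended edge object is initial. [cite: MochizukiSemiAnbd2006, Cor. 2.7(i) p.30] -/
noncomputable def isInitialExtendT {ec : ((𝒢.restrictFunctor H).obj A).coveringGraph.graph.Edge}
    (h : (⟨ec.1.1, ec.2⟩ : A.fibreData.total.Edge) ∉ K.edges) : IsInitial (A.extendT H K D ec) :=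
  IsInitial.ofIso initialIsInitial (eqToIso (dif_neg h : A.extendT H K D ec = ⊥_ _).symm)

/-- The gluing functors of `𝒢_{A|_ℍ}` preserve initial objects (they are exact).
[cite: MochizukiSemiAnbd2006, Def. 2.2(i) p.23] -/
theorem preservesColimit_empty_pull (bc : ((𝒢.restrictFunctor H).obj A).coveringGraph.graph.Branch)
    (vc : ((𝒢.restrictFunctor H).obj A).coveringGraph.graph.Vertex)
    (h : ((𝒢.restrictFunctor H).obj A).coveringGraph.graph.abuts bc = some vc) :
    PreservesColimit (Functor.empty.{0} _)
      (((𝒢.restrictFunctor H).obj A).coveringGraph.pull bc vc h).pullback := by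
  haveI : PreservesFiniteColimits (((𝒢.restrictFunctor H).obj A).coveringGraph.pull bc vc h).pullback :=
    (((𝒢.restrictFunctor H).obj A).coveringGraph.pull bc vc h).property.2
  infer_instance

/-- The gluing isomorphisms of the extension by initial objects: the given ones on `K` (through
`extendSIso`, `extendTIso`), the unique isomorphism of initial objects off `K` (clopenness).
[cite: MochizukiSemiAnbd2006, Cor. 2.7(i) p.30] -/
noncomputable def extendψ (bc : ((𝒢.restrictFunctor H).obj A).coveringGraph.graph.Branch)
    (vc : ((𝒢.restrictFunctor H).obj A).coveringGraph.graph.Vertex)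
    (h : ((𝒢.restrictFunctor H).obj A).coveringGraph.graph.abuts bc = some vc) :
    (((𝒢.restrictFunctor H).obj A).coveringGraph.pull bc vc h).pullback.obj (A.extendS H K D vc) ≅
      A.extendT H K D (((𝒢.restrictFunctor H).obj A).coveringGraph.graph.edgeOf bc) :=
  if hv : (⟨vc.1.1, vc.2⟩ : A.fibreData.total.Vertex) ∈ K.verts then
    (((𝒢.restrictFunctor H).obj A).coveringGraph.pull bc vc h).pullback.mapIso (A.extendSIso H K D hv) ≪≫
      D.ψ (A.kB H K bc ((hcl.1 bc vc h).mpr hv)) (A.kV H K vc hv) (A.abuts_kB H K h _ hv) ≪≫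
      (A.extendTIso H K D (ec := ((𝒢.restrictFunctor H).obj A).coveringGraph.graph.edgeOf bc)
        ((hcl.1 bc vc h).mpr hv)).symm
  else
    haveI := A.preservesColimit_empty_pull H bc vc h
    ((A.isInitialExtendS H K D hv).isInitialObj
        (((𝒢.restrictFunctor H).obj A).coveringGraph.pull bc vc h).pullback).uniqueUpToIso
      (A.isInitialExtendT H K D (ec := ((𝒢.restrictFunctor H).obj A).coveringGraph.graph.edgeOf bc)
        (fun he => hv ((hcl.1 bc vc h).mp he)))

/-- On `K`, the gluing isomorphism of the extension is the given one.
[cite: MochizukiSemiAnbd2006, Cor. 2.7(i) p.30] -/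
theorem extendψ_of_mem (bc : ((𝒢.restrictFunctor H).obj A).coveringGraph.graph.Branch)
    (vc : ((𝒢.restrictFunctor H).obj A).coveringGraph.graph.Vertex)
    (h : ((𝒢.restrictFunctor H).obj A).coveringGraph.graph.abuts bc = some vc)
    (hv : (⟨vc.1.1, vc.2⟩ : A.fibreData.total.Vertex) ∈ K.verts) :
    A.extendψ H K hcl D bc vc h =
      (((𝒢.restrictFunctor H).obj A).coveringGraph.pull bc vc h).pullback.mapIso (A.extendSIso H K D hv) ≪≫
        D.ψ (A.kB H K bc ((hcl.1 bc vc h).mpr hv)) (A.kV H K vc hv) (A.abuts_kB H K h _ hv) ≪≫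
        (A.extendTIso H K D (ec := ((𝒢.restrictFunctor H).obj A).coveringGraph.graph.edgeOf bc)
          ((hcl.1 bc vc h).mpr hv)).symm :=
  dif_pos hv

/-- **Extension by initial objects**, on objects: `D ∈ B(𝒢_A|_K)` extended by `∅` off `K` to an object of
`B(𝒢_{A|_ℍ})`. [cite: MochizukiSemiAnbd2006, Cor. 2.7(i) p.30] -/
noncomputable def extendObj : ((𝒢.restrictFunctor H).obj A).coveringGraph.BObj where
  S := A.extendS H K D
  T := A.extendT H K D
  ψ := A.extendψ H K hcl D

variable {D} {D' : (A.coveringGraph.restrict K).BObj} (k : D ⟶ D')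

/-- The vertex components of an extended morphism: the given ones on `K`, the (unique) maps of initial
objects off `K`. [cite: MochizukiSemiAnbd2006, Cor. 2.7(i) p.30] -/
noncomputable def extendFS (vc : ((𝒢.restrictFunctor H).obj A).coveringGraph.graph.Vertex) :
    A.extendS H K D vc ⟶ A.extendS H K D' vc :=
  if hv : (⟨vc.1.1, vc.2⟩ : A.fibreData.total.Vertex) ∈ K.verts then
    (A.extendSIso H K D hv).hom ≫ k.fS (A.kV H K vc hv) ≫ (A.extendSIso H K D' hv).inv
  else (A.isInitialExtendS H K D hv).to _

/-- The edge components of an extended morphism. [cite: MochizukiSemiAnbd2006, Cor. 2.7(i) p.30] -/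
noncomputable def extendFT (ec : ((𝒢.restrictFunctor H).obj A).coveringGraph.graph.Edge) :
    A.extendT H K D ec ⟶ A.extendT H K D' ec :=
  if he : (⟨ec.1.1, ec.2⟩ : A.fibreData.total.Edge) ∈ K.edges then
    (A.extendTIso H K D he).hom ≫ k.fT (A.kE H K ec he) ≫ (A.extendTIso H K D' he).inv
  else (A.isInitialExtendT H K D he).to _

/-- On `K`, the vertex component of the extended morphism is the given one.
[cite: MochizukiSemiAnbd2006, Cor. 2.7(i) p.30] -/
theorem extendFS_of_mem {vc : ((𝒢.restrictFunctor H).obj A).coveringGraph.graph.Vertex}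
    (hv : (⟨vc.1.1, vc.2⟩ : A.fibreData.total.Vertex) ∈ K.verts) :
    A.extendFS H K k vc =
      (A.extendSIso H K D hv).hom ≫ k.fS (A.kV H K vc hv) ≫ (A.extendSIso H K D' hv).inv :=
  dif_pos hv

/-- On `K`, the edge component of the extended morphism is the given one.
[cite: MochizukiSemiAnbd2006, Cor. 2.7(i) p.30] -/
theorem extendFT_of_mem {ec : ((𝒢.restrictFunctor H).obj A).coveringGraph.graph.Edge}
    (he : (⟨ec.1.1, ec.2⟩ : A.fibreData.total.Edge) ∈ K.edges) :
    A.extendFT H K k ec =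
      (A.extendTIso H K D he).hom ≫ k.fT (A.kE H K ec he) ≫ (A.extendTIso H K D' he).inv :=
  dif_pos he

/-- **Extension by initial objects**, on morphisms. [cite: MochizukiSemiAnbd2006, Cor. 2.7(i) p.30] -/
noncomputable def extendHom : A.extendObj H K hcl D ⟶ A.extendObj H K hcl D' where
  fS := A.extendFS H K k
  fT := A.extendFT H K k
  comm bc vc h := by
    by_cases hv : (⟨vc.1.1, vc.2⟩ : A.fibreData.total.Vertex) ∈ K.verts
    · have he : (⟨𝒢.graph.edgeOf bc.1.1, bc.2⟩ : A.fibreData.total.Edge) ∈ K.edges := (hcl.1 bc vc h).mpr hv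
      change (((𝒢.restrictFunctor H).obj A).coveringGraph.pull bc vc h).pullback.map (A.extendFS H K k vc) ≫
          (A.extendψ H K hcl D' bc vc h).hom =
        (A.extendψ H K hcl D bc vc h).hom ≫ A.extendFT H K k _
      rw [A.extendψ_of_mem H K hcl D bc vc h hv, A.extendψ_of_mem H K hcl D' bc vc h hv,
        A.extendFS_of_mem H K k hv, A.extendFT_of_mem H K k he]
      have hk : (((𝒢.restrictFunctor H).obj A).coveringGraph.pull bc vc h).pullback.map
            (k.fS (A.kV H K vc hv)) ≫ (D'.ψ (A.kB H K bc he) (A.kV H K vc hv) (A.abuts_kB H K h he hv)).hom =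
          (D.ψ (A.kB H K bc he) (A.kV H K vc hv) (A.abuts_kB H K h he hv)).hom ≫ k.fT _ :=
        k.comm (A.kB H K bc he) (A.kV H K vc hv) (A.abuts_kB H K h he hv)
      simp only [Iso.trans_hom, Functor.mapIso_hom, Iso.symm_hom, Functor.map_comp, Category.assoc,
        Iso.map_inv_hom_id_assoc]
      rw [← Category.assoc ((((𝒢.restrictFunctor H).obj A).coveringGraph.pull bc vc h).pullback.map
        (k.fS (A.kV H K vc hv))), hk]
      simp only [Category.assoc, Iso.inv_hom_id_assoc]
      rfl
    · haveI := A.preservesColimit_empty_pull H bc vc h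
      exact ((A.isInitialExtendS H K D hv).isInitialObj
        (((𝒢.restrictFunctor H).obj A).coveringGraph.pull bc vc h).pullback).hom_ext _ _

/-- **The extension-by-initial-objects functor `B(𝒢_A|_K) ⥤ B(𝒢_{A|_ℍ})`.**
[cite: MochizukiSemiAnbd2006, Cor. 2.7(i) p.30] -/
noncomputable def extendFunctor : (A.coveringGraph.restrict K).BObj ⥤ ((𝒢.restrictFunctor H).obj A).coveringGraph.BObj where
  obj D := A.extendObj H K hcl D
  map k := A.extendHom H K hcl k
  map_id D := by
    refine BObj.hom_ext _ _ (funext fun (vc : ((𝒢.restrictFunctor H).obj A).coveringGraph.graph.Vertex) => ?_)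
      (funext fun (ec : ((𝒢.restrictFunctor H).obj A).coveringGraph.graph.Edge) => ?_)
    · by_cases hv : (⟨vc.1.1, vc.2⟩ : A.fibreData.total.Vertex) ∈ K.verts
      · change A.extendFS H K (𝟙 D) vc = 𝟙 (A.extendS H K D vc)
        rw [A.extendFS_of_mem H K (𝟙 D) hv]
        change (A.extendSIso H K D hv).hom ≫ 𝟙 _ ≫ (A.extendSIso H K D hv).inv = _
        rw [Category.id_comp, Iso.hom_inv_id]
      · exact (A.isInitialExtendS H K D hv).hom_ext _ _
    · by_cases he : (⟨ec.1.1, ec.2⟩ : A.fibreData.total.Edge) ∈ K.edges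
      · change A.extendFT H K (𝟙 D) ec = 𝟙 (A.extendT H K D ec)
        rw [A.extendFT_of_mem H K (𝟙 D) he]
        change (A.extendTIso H K D he).hom ≫ 𝟙 _ ≫ (A.extendTIso H K D he).inv = _
        rw [Category.id_comp, Iso.hom_inv_id]
      · exact (A.isInitialExtendT H K D he).hom_ext _ _
  map_comp {D₁ D₂ D₃} f g := by
    refine BObj.hom_ext _ _ (funext fun (vc : ((𝒢.restrictFunctor H).obj A).coveringGraph.graph.Vertex) => ?_)
      (funext fun (ec : ((𝒢.restrictFunctor H).obj A).coveringGraph.graph.Edge) => ?_)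
    · by_cases hv : (⟨vc.1.1, vc.2⟩ : A.fibreData.total.Vertex) ∈ K.verts
      · change A.extendFS H K (f ≫ g) vc = A.extendFS H K f vc ≫ A.extendFS H K g vc
        rw [A.extendFS_of_mem H K (f ≫ g) hv, A.extendFS_of_mem H K f hv, A.extendFS_of_mem H K g hv]
        change (A.extendSIso H K D₁ hv).hom ≫ (f.fS _ ≫ g.fS _) ≫ (A.extendSIso H K D₃ hv).inv = _
        simp only [Category.assoc, Iso.inv_hom_id_assoc]
      · exact (A.isInitialExtendS H K _ hv).hom_ext _ _
    · by_cases he : (⟨ec.1.1, ec.2⟩ : A.fibreData.total.Edge) ∈ K.edges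
      · change A.extendFT H K (f ≫ g) ec = A.extendFT H K f ec ≫ A.extendFT H K g ec
        rw [A.extendFT_of_mem H K (f ≫ g) he, A.extendFT_of_mem H K f he, A.extendFT_of_mem H K g he]
        change (A.extendTIso H K D₁ he).hom ≫ (f.fT _ ≫ g.fT _) ≫ (A.extendTIso H K D₃ he).inv = _
        simp only [Category.assoc, Iso.inv_hom_id_assoc]
      · exact (A.isInitialExtendT H K _ he).hom_ext _ _

/-- **Restricting the extension gives back the object**: `extendFunctor ⋙ reindexRestrict ≅ 𝟭`.
[cite: MochizukiSemiAnbd2006, Cor. 2.7(i) p.30] -/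
noncomputable def extendRestrictIso :
    A.extendFunctor H K hcl ⋙ A.reindexRestrict H K hV hE ≅ 𝟭 _ :=
  BObj.natIsoOfComponents
    (fun kc => NatIso.ofComponents (fun D => A.extendSIso H K D (vc := A.vK H K hV kc) kc.2)
      (fun {D D'} k => by
        change A.extendFS H K k (A.vK H K hV kc) ≫ (A.extendSIso H K D' (vc := A.vK H K hV kc) kc.2).hom =
          (A.extendSIso H K D (vc := A.vK H K hV kc) kc.2).hom ≫ k.fS kc
        rw [A.extendFS_of_mem H K k (vc := A.vK H K hV kc) kc.2, Category.assoc, Category.assoc,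
          Iso.inv_hom_id, Category.comp_id]
        rfl))
    (fun ke => NatIso.ofComponents (fun D => A.extendTIso H K D (ec := A.eK H K hE ke) ke.2)
      (fun {D D'} k => by
        change A.extendFT H K k (A.eK H K hE ke) ≫ (A.extendTIso H K D' (ec := A.eK H K hE ke) ke.2).hom =
          (A.extendTIso H K D (ec := A.eK H K hE ke) ke.2).hom ≫ k.fT ke
        rw [A.extendFT_of_mem H K k (ec := A.eK H K hE ke) ke.2, Category.assoc, Category.assoc,
          Iso.inv_hom_id, Category.comp_id]
        rfl))
    (fun kb kc h D => by
      change ((A.coveringGraph.restrict K).pull kb kc h).pullback.map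
          (A.extendSIso H K D (vc := A.vK H K hV kc) kc.2).hom ≫ (D.ψ kb kc h).hom =
        (A.extendψ H K hcl D (A.bK H K hE kb) (A.vK H K hV kc) (A.abuts_bK H K hV hE h)).hom ≫
          (A.extendTIso H K D (ec := A.eK H K hE ((A.coveringGraph.restrict K).graph.edgeOf kb)) ((A.coveringGraph.restrict K).graph.edgeOf kb).2).hom
      have e12 : A.extendTIso H K D
            (ec := ((𝒢.restrictFunctor H).obj A).coveringGraph.graph.edgeOf (A.bK H K hE kb))
            ((hcl.1 _ _ (A.abuts_bK H K hV hE h)).mpr kc.2) =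
          A.extendTIso H K D (ec := A.eK H K hE ((A.coveringGraph.restrict K).graph.edgeOf kb)) ((A.coveringGraph.restrict K).graph.edgeOf kb).2 :=
        rfl
      rw [A.extendψ_of_mem H K hcl D (A.bK H K hE kb) (A.vK H K hV kc) (A.abuts_bK H K hV hE h) kc.2,
        Iso.trans_hom, Iso.trans_hom, Functor.mapIso_hom, Iso.symm_hom, e12, Category.assoc, Category.assoc,
        Iso.inv_hom_id, Category.comp_id]
      rfl)

end Extend

/-! ### The comparison functor `Over Z ⥤ B(𝒢_A|_K)` -/

/-- **The comparison functor** `B(𝒢_ℍ)_{/Z} ⥤ B(𝒢_A|_K)` for a morphism `m : Z ⟶ A|_ℍ` of `B(𝒢_ℍ)`: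
`(X → Z) ↦ (X → Z → A|_ℍ) ↦ {X_w ×_{S_w} P → P}_{(w,P) ∈ K}` — compose with `m`, compare with the
covering semi-graph of `A|_ℍ` (abc-iut-L3-t5's `toCovering`), restrict to `K`.
[cite: MochizukiSemiAnbd2006, Cor. 2.7(i) p.30] -/
noncomputable def restrictComparison {Z : (𝒢.restrict H).BObj}
    (m : Z ⟶ (𝒢.restrictFunctor H).obj A) : Over Z ⥤ (A.coveringGraph.restrict K).BObj :=
  Over.map m ⋙ ((𝒢.restrictFunctor H).obj A).toCovering ⋙ A.reindexRestrict H K hV hE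

end BObj

end SemiGraphOfAnabelioids

end Literature.AnabelianGeometry.SemiGraphs
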